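import Literature.NumberTheory.Automorphic.PlaneLatticesHermiteForm             -- ★ (L5-a): `IsUniformizingElement`, `𝒪[F]`
import Literature.NumberTheory.LocalFields.RamifiedQuadraticNormCriterion      -- ★ B-p10 (g26): `RamifiedQuadraticNorm.residue_map_eq`
import HarnessLib

/-!
# [LabesseLanglands1979 §2 p. 8; Rogawski1990 §4.9] road «R1-ram» (tamely RAMIFIED place): THE DEPTH OF A REGULAR NORM-ONE TORUS ELEMENT IS ODD —
# `σa·a = σc·c = 1`, `|a − c| = |ϖ^N|`, `N ≥ 1`, `σϖ = −ϖ`, `σ` residually trivial, `2 ∈ 𝒪ˣ` ⇒ `N` odd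

Topic `NumberTheory/Automorphic`; namespace `Literature.NumberTheory.Automorphic`.  THEOREMS ONLY (no definition, no instance, no notation, no named fact, no `sorry`).
Cell `pub/hodgecm-mathlib` (D-0151), crux H413 = `stmt-HodgeConjecture-24833`, residue `RankOneUnstableTransferNonsplitCMERamified` of #159; architect A-p16 (g27) A-19∕A-22:
the R-5b END (F0P3a-p03 (g12)) feeds ★ `exists_eventually_mul_eq_const_of_signedExpansion ∕ _signedWindow` whose normalisation `b^{(N t − 1)∕2}` ∕ parity binder `hNpar`
(`N t % 2 = p`) wants the depth `N(t) = ord_ϖ(u₀(t) − u₁(t))` to be ODD near the singular points; memo (R5b-α) ba95cded SETTING («`N` is ODD — `z ∈ E¹`, `z ≡ 1` forces odd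
`ord(z−1)`»).  This file is that one-line fact, in the binder shape of ★ B-p12 R-3 FILES 1–7 and ★ A-p01 R2-C∕D (`hN : valuation F (a − c) = valuation F (ϖ ^ N)`).
HONEST LABEL: HC_CM is proved only modulo the printed citations (the 2 remaining named inputs hLiu418, h413) until rung 0 closes; nothing printed is asserted here.

PROOF.  `w := a − c = ϖ^N u` with `u` a unit; `σw = σa − σc = a⁻¹ − c⁻¹ = −w∕(ac)`, so `(−1)^N·σu·(ac) = −u`.  Residually `σu ≡ u`, and `a ≡ c`, `ā·σ̄ā = ā² = 1` give
`ac ≡ 1`; hence `((−1)^N + 1)·ū = 0` with `ū ≠ 0` and `2 ≠ 0` in `𝓀`: `N` is odd.  Heads: **`odd_of_valuation_sub_eq_of_norm_one`** (and the `N = 0` dichotomy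
`eq_zero_or_odd_of_valuation_sub_eq_of_norm_one`).

## References
* [LabesseLanglands1979] J.-P. Labesse, R. P. Langlands, *L-indistinguishability for SL(2)*, Canad. J. Math. 31 (1979): §2, p. 8 (the ramified torus `T`, odd conductor exponents).
* [Rogawski1990] J. D. Rogawski, *Automorphic Representations of Unitary Groups in Three Variables*, Ann. of Math. Stud. 123 (1990): §4.9 Lemma 4.9.3 p. 56.
* [Serre1979] J.-P. Serre, *Local Fields* (1979): Ch. V §3.
-/

set_option autoImplicit false

noncomputable section

open scoped ValuativeRel
open ValuativeRel

namespace Literature.NumberTheory.Automorphic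

variable {F : Type*} [Field F] [ValuativeRel F]

section Parity

variable (σ : F →+* F) {ϖ : F} (hϖ : IsUniformizingElement ϖ) (hσϖ : σ ϖ = -ϖ)
  (σO : 𝒪[F] →+* 𝒪[F]) (hσO : ∀ x : 𝒪[F], ((σO x : 𝒪[F]) : F) = σ x)

/-- `|x| = 1 ⇒ x ∈ 𝒪`. [cite: Serre1979, Ch. V §2] -/
private theorem mem_of_valuation_eq_one'' {x : F} (hx : valuation F x = 1) : x ∈ 𝒪[F] :=
  (Valuation.mem_integer_iff _ _).2 hx.le

/-- `|x| = 1 ⇒ x ≠ 0`. [cite: Serre1979, Ch. V §2] -/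
private theorem ne_zero_of_valuation_eq_one'' {x : F} (hx : valuation F x = 1) : x ≠ 0 := by
  intro h; rw [h, map_zero] at hx; exact zero_ne_one hx

include hϖ hσϖ hσO in
/-- **THE DEPTH OF A REGULAR NORM-ONE ELEMENT IS ODD (tamely ramified place).**  `σa·a = σc·c = 1`, `|a| = |c| = 1`, `|a − c| = |ϖ^N|` with `1 ≤ N`; `σϖ = −ϖ`,
`σ` residually trivial on `𝒪`, `2 ∈ 𝒪ˣ`.  Then `N` is odd. [cite: LabesseLanglands1979, §2 p. 8] [cite: Rogawski1990, §4.9 Lemma 4.9.3 p. 56] [cite: Serre1979, Ch. V §3] -/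
theorem odd_of_valuation_sub_eq_of_norm_one (h2 : IsUnit (2 : 𝒪[F])) (hres : ∀ x : 𝒪[F], σO x - x ∈ IsLocalRing.maximalIdeal 𝒪[F])
    {a c : F} (ha : σ a * a = 1) (hc : σ c * c = 1) (ha1 : valuation F a = 1) (hc1 : valuation F c = 1)
    {N : ℕ} (hN : valuation F (a - c) = valuation F (ϖ ^ N)) (hN1 : 1 ≤ N) : Odd N := by
  have hϖ0 : ϖ ≠ 0 := hϖ.ne_zero
  have hϖN0 : (ϖ : F) ^ N ≠ 0 := pow_ne_zero _ hϖ0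
  have hϖN1 : valuation F (ϖ ^ N) ≠ 0 := (Valuation.ne_zero_iff _).2 hϖN0
  have ha0 : a ≠ 0 := ne_zero_of_valuation_eq_one'' ha1
  have hc0 : c ≠ 0 := ne_zero_of_valuation_eq_one'' hc1
  have hσa : σ a = a⁻¹ := eq_inv_of_mul_eq_one_left ha
  have hσc : σ c = c⁻¹ := eq_inv_of_mul_eq_one_left hc
  -- the unit part `u` of `a − c`
  set u : F := (a - c) * (ϖ ^ N)⁻¹ with hu
  have hu1 : valuation F u = 1 := by rw [hu, map_mul, map_inv₀, hN, mul_inv_cancel₀ hϖN1]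
  have hac' : a - c = ϖ ^ N * u := by rw [hu, mul_comm, inv_mul_cancel_right₀ hϖN0]
  -- `σ(a − c) = −(a − c)∕(ac)` ⇒ `(−1)^N σu · (a c) = −u`
  have hσpow : σ (ϖ ^ N) = (-1) ^ N * ϖ ^ N := by rw [map_pow, hσϖ, neg_eq_neg_one_mul, mul_pow]
  have key : (-1) ^ N * σ u * (a * c) = -u := by
    have h1 : σ (a - c) * (a * c) = -(a - c) := by rw [map_sub, hσa, hσc]; field_simp; ring
    rw [hac', map_mul, hσpow] at h1
    have h3 : ϖ ^ N * ((-1) ^ N * σ u * (a * c)) = ϖ ^ N * (-u) := by linear_combination h1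
    exact mul_left_cancel₀ hϖN0 h3
  -- pass to the residue field of `𝒪`
  rcases Nat.even_or_odd N with hev | hodd
  · exfalso
    rw [hev.neg_one_pow, one_mul] at key
    have haO : a ∈ 𝒪[F] := mem_of_valuation_eq_one'' ha1
    have hcO : c ∈ 𝒪[F] := mem_of_valuation_eq_one'' hc1
    have huO : u ∈ 𝒪[F] := mem_of_valuation_eq_one'' hu1
    set aO : 𝒪[F] := ⟨a, haO⟩ with haO'
    set cO : 𝒪[F] := ⟨c, hcO⟩ with hcO'
    set uO : 𝒪[F] := ⟨u, huO⟩ with huO'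
    set ϖO : 𝒪[F] := ⟨ϖ, hϖ.mem⟩ with hϖO'
    have keyO : σO uO * (aO * cO) = -uO := Subtype.ext (by push_cast; rw [hσO]; exact key)
    have haaO : σO aO * aO = 1 := Subtype.ext (by push_cast; rw [hσO]; exact ha)
    obtain ⟨d, rfl⟩ := Nat.exists_eq_add_of_le hN1
    have hacO : aO - cO = ϖO * (ϖO ^ d * uO) := Subtype.ext (by push_cast; rw [hac', pow_add, pow_one]; ring)
    have hϖres : IsLocalRing.residue 𝒪[F] ϖO = 0 := by
      rw [IsLocalRing.residue_eq_zero_iff, IsLocalRing.mem_maximalIdeal, mem_nonunits_iff,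
        (Valuation.integer.integers (valuation F)).isUnit_iff_valuation_eq_one]
      exact hϖ.valuation_lt_one.ne
    have hres_ac : IsLocalRing.residue 𝒪[F] aO = IsLocalRing.residue 𝒪[F] cO := by
      rw [← sub_eq_zero, ← map_sub, hacO, map_mul, hϖres, zero_mul]
    have hres_a2 : IsLocalRing.residue 𝒪[F] aO * IsLocalRing.residue 𝒪[F] aO = 1 := by
      have h := congrArg (IsLocalRing.residue 𝒪[F]) haaO
      rwa [map_mul, map_one, LocalFields.RamifiedQuadraticNorm.residue_map_eq σO hres aO] at h
    have hres_key : IsLocalRing.residue 𝒪[F] uO * 2 = 0 := by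
      have h := congrArg (IsLocalRing.residue 𝒪[F]) keyO
      rw [map_mul, map_mul, map_neg, LocalFields.RamifiedQuadraticNorm.residue_map_eq σO hres uO, ← hres_ac, hres_a2, mul_one] at h
      linear_combination h
    have hu_unit : IsUnit uO := (Valuation.integer.integers (valuation F)).isUnit_iff_valuation_eq_one.2 hu1
    have hures : IsLocalRing.residue 𝒪[F] uO ≠ 0 := (IsLocalRing.residue_ne_zero_iff_isUnit uO).2 hu_unit
    have h2res : (2 : IsLocalRing.ResidueField 𝒪[F]) ≠ 0 := by
      have h := (IsLocalRing.residue_ne_zero_iff_isUnit (2 : 𝒪[F])).2 h2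
      rwa [map_ofNat] at h
    exact mul_ne_zero hures h2res hres_key
  · exact hodd

include hϖ hσϖ hσO in
/-- **DICHOTOMY**: under the same hypotheses but without `1 ≤ N`, either `N = 0` (`a ≢ c` residually — no congruence, no fixed facet beyond the midpoint) or `N` is odd.
[cite: LabesseLanglands1979, §2 p. 8] [cite: Rogawski1990, §4.9 Lemma 4.9.3 p. 56] -/
theorem eq_zero_or_odd_of_valuation_sub_eq_of_norm_one (h2 : IsUnit (2 : 𝒪[F])) (hres : ∀ x : 𝒪[F], σO x - x ∈ IsLocalRing.maximalIdeal 𝒪[F])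
    {a c : F} (ha : σ a * a = 1) (hc : σ c * c = 1) (ha1 : valuation F a = 1) (hc1 : valuation F c = 1)
    {N : ℕ} (hN : valuation F (a - c) = valuation F (ϖ ^ N)) : N = 0 ∨ Odd N := by
  rcases Nat.eq_zero_or_pos N with h0 | hpos
  · exact Or.inl h0
  · exact Or.inr (odd_of_valuation_sub_eq_of_norm_one σ hϖ hσϖ σO hσO h2 hres ha hc ha1 hc1 hN hpos)

end Parity

end Literature.NumberTheory.Automorphic

end
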